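import Summits.BirchSwinnertonDyer.BirchSwinnertonDyer.Theorems.GenusKolyvaginAtTwoPowDvdShaCardAtTwoRTHeegnerTwinTamagawaValuation
import Summits.BirchSwinnertonDyer.BirchSwinnertonDyer.Theorems.GenusKolyvaginAtTwoEquivariantKolyvaginExactAtTwoArchimedeanSelmerLevel
import HarnessLib

/-!
# Route `GenusKolyvaginAtTwo`, LINE 18 (L_T `PowDvdShaCardAtTwoRT`, stmt-BirchSwinnertonDyer-23242, `Δ < 0`): the genus budget for
# the bare preimage `res⁻¹(Sel^(n)(W_K/K))` — on `Δ < 0` the real condition is automatic (`H¹(ℝ, E) = 0`)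

Seat `bsd-line-gk2-p3` g17 (cell `bsd-f1-sign2`), `--supports stmt-BirchSwinnertonDyer-23242` (helper; closes nothing).
THEOREMS ONLY (no definition, no named fact, no `sorry`); BSD is not proved by any of this.

The budget theorems of this lineage (`…RTRelaxedSelmerGenusBudget{,Heegner}`, `…RTHeegnerTwinTamagawaValuation`) bound the index of
`Sel^(n)(W/ℚ)` in `res⁻¹(Sel^(n)(W_K/K)) ⊓ ⨅_∞ (ℝ-condition)`.  On the LINE 18 habitat `Δ_W < 0`, complex conjugation moves a
`2`-torsion point, so `H¹(ℝ, E) = 0` and the `ℝ`-condition holds for EVERY class (the tree's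
`GenusExact.ArchVanishing.selmerLocalKer_infinitePlace_eq_top_of_Δ_neg`, from `…ArchimedeanVanishing{,NegDisc}`): the relaxed group
is the bare preimage `res⁻¹(Sel^(n)(W_K/K))` — exactly the group through which the (+)-descent of 3a‴ reads Kolyvagin's classes
over `ℚ` — and

* `relIndex_selmerGroup_comap_resTorsion_le_prod_natCard_twoTorsion_of_Δ_neg` — `[res⁻¹(Sel(W_K)) : Sel(W/ℚ)] ≤ ∏_{p ∣ d_K} #E(ℚ_p)[2]`;
* `relIndex_selmerGroup_comap_resTorsion_le_two_pow_padicValNat_tamagawaProduct_twin_of_Δ_neg` — `… ≤ 2^{ord₂ C(Wd)}` for any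
  model `Wd` of the Heegner twist when `C(W)` is odd (the LINE 18 frame), i.e. in the currency of `stub_twinLadderGenus`.

(On `Δ > 0` — LINE 19 — `H¹(ℝ, E) ≅ ℤ/2` and the archimedean intersection genuinely costs one bit, the `i_∞ = 1` of the pen's
instrument law; not treated here.)

References: [Kramer1981] §2 Prop. 3, Thm. 1; [GrossLMS1991] §1; [MazurRubin2010] Prop. 3.3; [SilvermanAEC2009] X.§4.
-/

set_option autoImplicit false
-- the Theorems namespace of this sub repeats the summit name by design (D-0017 nested layout)
set_option linter.dupNamespace false

noncomputable section

open scoped Classical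

namespace Summit.BirchSwinnertonDyer.BirchSwinnertonDyer.Theorems.GenusExact.PlusDescent

open WeierstrassCurve NumberField IsDedekindDomain Rat.HeightOneSpectrum Literature.NumberTheory.EllipticCurves
  Literature.Barriers.BirchSwinnertonDyer

variable (W : WeierstrassCurve ℚ) [W.IsElliptic] (K : Type) [Field K] [NumberField K]

/-- **On `Δ < 0` the archimedean Selmer condition over `ℚ` is automatic**: `⨅_∞ selmerLocalKer = ⊤` (ℚ has one infinite
place, real, and `H¹(ℝ, E) = 0` when complex conjugation moves a `2`-torsion point —
`GenusExact.ArchVanishing.selmerLocalKer_infinitePlace_eq_top_of_Δ_neg`). [cite: SilvermanAEC2009, X.§4 (local conditions)] -/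
theorem iInf_selmerLocalKer_infinitePlace_eq_top_of_Δ_neg (hΔ : W.Δ < 0) (n : ℤ) :
    (⨅ w : InfinitePlace ℚ, selmerLocalKer W w.Completion n) = ⊤ :=
  iInf_eq_top.mpr fun w ↦ ArchVanishing.selmerLocalKer_infinitePlace_eq_top_of_Δ_neg W w hΔ n

/-- **`Δ < 0`: the `d_K`-relaxed Selmer group is the bare preimage `res⁻¹(Sel^(n)(W_K/K))`** (no archimedean intersection
needed). [cite: SilvermanAEC2009, X.§4 (local conditions)] -/
theorem comap_resTorsion_inf_iInf_eq_of_Δ_neg (hΔ : W.Δ < 0) (n : ℤ) :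
    (selmerGroup (W.baseChange K) n).comap (resTorsion W K n) ⊓ (⨅ w : InfinitePlace ℚ, selmerLocalKer W w.Completion n) =
      (selmerGroup (W.baseChange K) n).comap (resTorsion W K n) := by
  rw [iInf_selmerLocalKer_infinitePlace_eq_top_of_Δ_neg W hΔ n, inf_top_eq]

/-- **THE GENUS BUDGET ON `Δ < 0` FOR THE BARE PREIMAGE**: `W/ℚ` elliptic with `Δ_W < 0`, `K` imaginary quadratic with odd `d_K`
and the Heegner hypothesis for `N_W`; then for every level `n`,
`[res⁻¹(Sel^(n)(W_K/K)) : Sel^(n)(W/ℚ)] ≤ ∏_{p ∣ d_K} #E(ℚ_p)[2]`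
(`relIndex_selmerGroup_relaxed_le_prod_natCard_twoTorsion_of_heegner` with the archimedean condition discharged).
[cite: Kramer1981, §2 Prop. 3 and Thm. 1] [cite: MazurRubin2010, Prop. 3.3] -/
theorem relIndex_selmerGroup_comap_resTorsion_le_prod_natCard_twoTorsion_of_Δ_neg (hΔ : W.Δ < 0)
    (hIQ : IsImaginaryQuadratic K) (hodd : Odd (NumberField.discr K))
    (hHe : SatisfiesHeegnerHypothesis (W.conductorNorm ℤ) K) (n : ℤ) :
    (selmerGroup W n).relIndex ((selmerGroup (W.baseChange K) n).comap (resTorsion W K n)) ≤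
      ∏ p ∈ (NumberField.discr K).natAbs.primeFactors,
        Nat.card {P : (W.baseChange ((Matsuno2009.primePlace p).adicCompletion ℚ)).toAffine.Point // 2 • P = 0} := by
  rw [← comap_resTorsion_inf_iInf_eq_of_Δ_neg W K hΔ n]
  exact relIndex_selmerGroup_relaxed_le_prod_natCard_twoTorsion_of_heegner W K hIQ hodd hHe n

/-- **The same on `Δ < 0` in the currency of the lever 3a‴: `[res⁻¹(Sel^(n)(W_K/K)) : Sel^(n)(W/ℚ)] ≤ 2^{ord₂ C(Wd)}`** for `W`
globally minimal with `C(W)` odd and `Wd = Cd • W^{(d_K)}` any model of the Heegner twist (the LINE 18 frame;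
`relIndex_selmerGroup_relaxed_le_two_pow_padicValNat_tamagawaProduct_twin`). [cite: Kramer1981, §2 Prop. 3 and Thm. 1]
[cite: BoxerDiao2010, proof of Prop. 4.1 (p. 1977)] -/
theorem relIndex_selmerGroup_comap_resTorsion_le_two_pow_padicValNat_tamagawaProduct_twin_of_Δ_neg [W.IsGloballyMinimal]
    (hΔ : W.Δ < 0) (hIQ : IsImaginaryQuadratic K) (hodd : Odd (NumberField.discr K))
    (hHe : SatisfiesHeegnerHypothesis (W.conductorNorm ℤ) K) (hT : Odd W.tamagawaProduct)
    {Wd : WeierstrassCurve ℚ} [Wd.IsElliptic] (Cd : VariableChange ℚ)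
    (hWd : Cd • W.quadraticTwist (NumberField.discr K : ℚ) = Wd) (n : ℤ) :
    (selmerGroup W n).relIndex ((selmerGroup (W.baseChange K) n).comap (resTorsion W K n)) ≤
      2 ^ padicValNat 2 Wd.tamagawaProduct := by
  rw [← comap_resTorsion_inf_iInf_eq_of_Δ_neg W K hΔ n]
  exact relIndex_selmerGroup_relaxed_le_two_pow_padicValNat_tamagawaProduct_twin W hIQ hodd hHe hT Cd hWd n

end Summit.BirchSwinnertonDyer.BirchSwinnertonDyer.Theorems.GenusExact.PlusDescent

end
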